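import Summits.KontsevichZagierPeriods.KontsevichZagierPeriods.Theorems.SoloBlindLemniscateLine
import Summits.KontsevichZagierPeriods.KontsevichZagierPeriods.Theorems.SoloBlindSubgraph
import HarnessLib

/-!
# The Fermat cubic regions: two ℚ-rational representations of `B(⅓,⅓)/6` and `B(⅔,⅔)/6`

Two bounded planar regions with `ℚ`-polynomial boundaries,

* `F_A = {0 < x < 1, 0 ≤ y, x³ + y³ ≤ 1}` — the quadrant of the Fermat cubic `x³ + y³ = 1`,
  area `∫₀¹ (1-x³)^{1/3} dx = B(⅓,⅓)/6 = Γ(⅓)³·√3/(12π)`;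
* `F_B = {0 < x < 1, 0 ≤ y, y³ ≤ x³(1-x³)²}`, area `∫₀¹ x(1-x³)^{2/3} dx = B(⅔,⅔)/6`,

and their classes in `Q = FormalRep / relations` by KZ moves only: `[F_A] = (1/6)•β(⅓,⅓)`
(`mkQ_fermatA2`), `[F_B] = (1/6)•β(⅔,⅔)` (`mkQ_fermatB2`) — each by ONE Newton–Leibniz move to
the line (`subgraph_sub_lineRep`), ONE substitution `t = x³` and ONE translation (`betaQ_transl`).
These are the ℚ-rational members of the equianharmonic sector (`SoloBlindEquianharmonic`).
-/

noncomputable section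

namespace Summit.KontsevichZagierPeriods.KontsevichZagierPeriods.Theorems

open Set MeasureTheory
open Literature.ModelTheory.ExponentialFields (IsSemialgebraic)
open MvPolynomial (aeval X C)
open Literature.NumberTheory.Transcendental
open Literature.NumberTheory.Transcendental.KZ

namespace SoloBlind

/-! ## Elementary facts on `(0,1)` -/

section estimates

variable {x : ℝ}

/-- `x³ < 1` on `(0,1)`. -/
theorem pow_three_lt_one (hx : x ∈ Ioo (0:ℝ) 1) : x ^ 3 < 1 :=
  pow_lt_one₀ hx.1.le hx.2 (by norm_num)

/-- `0 < 1 - x³` on `(0,1)`. -/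
theorem one_sub_pow_three_pos (hx : x ∈ Ioo (0:ℝ) 1) : 0 < 1 - x ^ 3 :=
  sub_pos.mpr (pow_three_lt_one hx)

/-- The exponent `4/3 - 1 = 1/3`. -/
theorem fourThirds_sub_one : ((((4:ℚ) / 3 : ℚ) : ℝ) - 1) = (1:ℝ) / 3 := by
  push_cast
  norm_num

/-- The exponent `5/3 - 1 = 2/3`. -/
theorem fiveThirds_sub_one : ((((5:ℚ) / 3 : ℚ) : ℝ) - 1) = (2:ℝ) / 3 := by
  push_cast
  norm_num

/-- `(w^{1/3})³ = w` for `w ≥ 0`. -/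
theorem rpow_third_pow_three {w : ℝ} (hw : 0 ≤ w) :
    (w ^ ((((4:ℚ) / 3 : ℚ) : ℝ) - 1)) ^ 3 = w := by
  rw [fourThirds_sub_one, ← Real.rpow_natCast, ← Real.rpow_mul hw]
  norm_num

/-- `(w^{2/3})³ = w²` for `w ≥ 0`. -/
theorem rpow_twoThirds_pow_three {w : ℝ} (hw : 0 ≤ w) :
    (w ^ ((((5:ℚ) / 3 : ℚ) : ℝ) - 1)) ^ 3 = w ^ 2 := by
  rw [fiveThirds_sub_one, ← Real.rpow_natCast, ← Real.rpow_mul hw, ← Real.rpow_natCast w 2]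
  norm_num

/-- `y ≤ c ↔ y³ ≤ c³` for `y, c ≥ 0`. -/
theorem le_iff_pow_three_le {y c : ℝ} (hy : 0 ≤ y) (hc : 0 ≤ c) : y ≤ c ↔ y ^ 3 ≤ c ^ 3 :=
  (pow_le_pow_iff_left₀ hy hc three_ne_zero).symm

end estimates

/-! ## The two one-dimensional algebraic representations -/

/-- The integrand `(1-x³)^{1/3}` of `F_A` on the line. -/
def fermatA (x : ℝ) : ℝ := (1 - x ^ 3) ^ ((((4:ℚ) / 3 : ℚ) : ℝ) - 1)

/-- The integrand `x(1-x³)^{2/3}` of `F_B` on the line. -/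
def fermatB (x : ℝ) : ℝ := x * (1 - x ^ 3) ^ ((((5:ℚ) / 3 : ℚ) : ℝ) - 1)

/-- `fermatA ≥ 0`. -/
theorem fermatA_nonneg {x : ℝ} (hx : x ∈ Ioo (0:ℝ) 1) : 0 ≤ fermatA x :=
  Real.rpow_nonneg (one_sub_pow_three_pos hx).le _

/-- `fermatB ≥ 0` on `(0,1)`. -/
theorem fermatB_nonneg {x : ℝ} (hx : x ∈ Ioo (0:ℝ) 1) : 0 ≤ fermatB x :=
  mul_nonneg hx.1.le (Real.rpow_nonneg (one_sub_pow_three_pos hx).le _)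

/-- `fermatA` is continuous. -/
theorem continuous_fermatA : Continuous fermatA :=
  (by fun_prop : Continuous fun x : ℝ => 1 - x ^ 3).rpow_const fun _ =>
    Or.inr (by rw [fourThirds_sub_one]; norm_num)

/-- `fermatB` is continuous. -/
theorem continuous_fermatB : Continuous fermatB :=
  continuous_id.mul ((by fun_prop : Continuous fun x : ℝ => 1 - x ^ 3).rpow_const fun _ =>
    Or.inr (by rw [fiveThirds_sub_one]; norm_num))

/-- `fermatA` is integrable on `(0,1)` (continuous on `[0,1]`). -/
theorem integrableOn_fermatA : IntegrableOn fermatA (Ioo 0 1) :=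
  (continuous_fermatA.continuousOn.integrableOn_Icc (μ := volume)).mono_set Ioo_subset_Icc_self

/-- `fermatB` is integrable on `(0,1)`. -/
theorem integrableOn_fermatB : IntegrableOn fermatB (Ioo 0 1) :=
  (continuous_fermatB.continuousOn.integrableOn_Icc (μ := volume)).mono_set Ioo_subset_Icc_self

/-- `fermatA` is `ℚ`-semialgebraic on `(0,1)`. -/
theorem isSemialgebraicFunOn_fermatA :
    IsSemialgebraicFunOn ℚ (line (Ioo 0 1)) (fun x : Fin 1 → ℝ => fermatA (x 0)) := by
  have h := isSemialgebraicFunOn_mellinIntegrand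
    (isSemialgebraic_line_Ioo isAlgebraic_zero isAlgebraic_one)
    ![(1 - X 0 ^ 3 : MvPolynomial (Fin 1) ℚ)] ![((4:ℚ) / 3 - 1 : ℚ)] 1 (fun x hx k => by
      have hx : x 0 ∈ Ioo (0:ℝ) 1 := hx
      simpa using one_sub_pow_three_pos hx)
  refine h.congr fun x hx => ?_
  simp only [mellinIntegrand_apply, Fin.prod_univ_one, Matrix.cons_val_fin_one, map_sub, map_one,
    map_pow, MvPolynomial.aeval_X, fermatA]
  push_cast
  ring_nf

/-- `fermatB` is `ℚ`-semialgebraic on `(0,1)`. -/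
theorem isSemialgebraicFunOn_fermatB :
    IsSemialgebraicFunOn ℚ (line (Ioo 0 1)) (fun x : Fin 1 → ℝ => fermatB (x 0)) := by
  have h := isSemialgebraicFunOn_mellinIntegrand
    (isSemialgebraic_line_Ioo isAlgebraic_zero isAlgebraic_one)
    ![(1 - X 0 ^ 3 : MvPolynomial (Fin 1) ℚ)] ![((5:ℚ) / 3 - 1 : ℚ)] 1 (fun x hx k => by
      have hx : x 0 ∈ Ioo (0:ℝ) 1 := hx
      simpa using one_sub_pow_three_pos hx)
  refine (IsSemialgebraicFunOn.mul_holds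
    (isSemialgebraicFunOn_aeval (isSemialgebraic_line_Ioo isAlgebraic_zero isAlgebraic_one)
      (X 0 : MvPolynomial (Fin 1) ℚ)) h).congr fun x hx => ?_
  simp only [Pi.mul_apply, mellinIntegrand_apply, Fin.prod_univ_one, Matrix.cons_val_fin_one,
    map_sub, map_one, map_pow, MvPolynomial.aeval_X, fermatB]
  push_cast
  ring_nf

/-- **`F_A¹ = [(0,1), (1-x³)^{1/3}]`.** -/
def fermatA1 : IntegralRep 1 :=
  lineRep (Ioo 0 1) fermatA (isSemialgebraic_line_Ioo isAlgebraic_zero isAlgebraic_one)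
    isSemialgebraicFunOn_fermatA integrableOn_fermatA

/-- **`F_B¹ = [(0,1), x(1-x³)^{2/3}]`.** -/
def fermatB1 : IntegralRep 1 :=
  lineRep (Ioo 0 1) fermatB (isSemialgebraic_line_Ioo isAlgebraic_zero isAlgebraic_one)
    isSemialgebraicFunOn_fermatB integrableOn_fermatB

/-! ## The change of variables `t = x³` -/

/-- `x ↦ x³` is `ℚ`-semialgebraic on `(0,1)`. -/
theorem isSemialgebraicFunOn_pow_three :
    IsSemialgebraicFunOn ℚ (line (Ioo 0 1)) (fun x : Fin 1 → ℝ => x 0 ^ 3) :=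
  (isSemialgebraicFunOn_aeval (isSemialgebraic_line_Ioo isAlgebraic_zero isAlgebraic_one)
    (X 0 ^ 3 : MvPolynomial (Fin 1) ℚ)).congr fun x _ => by simp

/-- `d(x³)/dx = 3x²` within any set. -/
theorem hasDerivWithinAt_pow_three (S : Set ℝ) (t : ℝ) :
    HasDerivWithinAt (fun x : ℝ => x ^ 3) (3 * t ^ 2) S t := by
  simpa using (hasDerivAt_pow 3 t).hasDerivWithinAt

/-- `x ↦ x³` is injective on `(0,1)`. -/
theorem injOn_pow_three : InjOn (fun x : ℝ => x ^ 3) (Ioo 0 1) := fun x hx y hy h =>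
  (pow_left_inj₀ hx.1.le hy.1.le (by norm_num : (3:ℕ) ≠ 0)).mp h

/-- `x ↦ x³` maps `(0,1)` onto `(0,1)`. -/
theorem image_pow_three : Ioo (0:ℝ) 1 = (fun x : ℝ => x ^ 3) '' Ioo 0 1 := by
  ext t
  constructor
  · rintro ⟨h0, h1⟩
    refine ⟨t ^ ((1:ℝ) / 3), ⟨Real.rpow_pos_of_pos h0 _, Real.rpow_lt_one h0.le h1 (by norm_num)⟩,
      ?_⟩
    show (t ^ ((1:ℝ) / 3)) ^ 3 = t
    rw [← Real.rpow_natCast, ← Real.rpow_mul h0.le]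
    norm_num
  · rintro ⟨x, hx, rfl⟩
    exact ⟨pow_pos hx.1 3, pow_three_lt_one hx⟩

section pullback

variable {x : ℝ}

/-- `(x³)^{1/3 - 1} = x⁻²` for `x > 0`. -/
theorem pow_three_rpow_third_sub_one (hx : 0 < x) :
    (x ^ 3) ^ ((((1:ℚ) / 3 : ℚ) : ℝ) - 1) = (x ^ 2)⁻¹ := by
  rw [← Real.rpow_natCast x 3, ← Real.rpow_mul hx.le, ← Real.rpow_natCast x 2,
    ← Real.rpow_neg hx.le]
  norm_num

/-- `(x³)^{2/3 - 1} = x⁻¹` for `x > 0`. -/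
theorem pow_three_rpow_twoThirds_sub_one (hx : 0 < x) :
    (x ^ 3) ^ ((((2:ℚ) / 3 : ℚ) : ℝ) - 1) = x⁻¹ := by
  rw [← Real.rpow_natCast x 3, ← Real.rpow_mul hx.le, ← Real.rpow_neg_one]
  norm_num

/-- The pull-back identity for `F_A`: `(1-x³)^{1/3} = ⅓ (x³)^{-2/3}(1-x³)^{1/3} · |3x²|`. -/
theorem fermatA_pullback (hx : x ∈ Ioo (0:ℝ) 1) :
    fermatA x = (((1:ℚ) / 3 : ℚ) : ℝ) * ((x ^ 3) ^ ((((1:ℚ) / 3 : ℚ) : ℝ) - 1) *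
        (1 - x ^ 3) ^ ((((4:ℚ) / 3 : ℚ) : ℝ) - 1)) * |3 * x ^ 2| := by
  have h0 := hx.1
  rw [fermatA, pow_three_rpow_third_sub_one h0, abs_of_pos (by positivity)]
  push_cast
  field_simp

/-- The pull-back identity for `F_B`: `x(1-x³)^{2/3} = ⅓ (x³)^{-1/3}(1-x³)^{2/3} · |3x²|`. -/
theorem fermatB_pullback (hx : x ∈ Ioo (0:ℝ) 1) :
    fermatB x = (((1:ℚ) / 3 : ℚ) : ℝ) * ((x ^ 3) ^ ((((2:ℚ) / 3 : ℚ) : ℝ) - 1) *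
        (1 - x ^ 3) ^ ((((5:ℚ) / 3 : ℚ) : ℝ) - 1)) * |3 * x ^ 2| := by
  have h0 := hx.1
  rw [fermatB, pow_three_rpow_twoThirds_sub_one h0, abs_of_pos (by positivity)]
  push_cast
  field_simp

end pullback

/-- **Move (`t = x³`): `F_A¹ ≡ ⅓ · β(⅓, 4/3)`.** -/
theorem fermatA1_sub_beta :
    of fermatA1 - of ((betaRep (1 / 3) (4 / 3) (by norm_num) (by norm_num)).constMul
      (((1:ℚ) / 3 : ℚ) : ℝ) (isAlgebraic_rat ℚ _)) ∈ relations := by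
  rw [betaRep_constMul_eq_lineRep]
  unfold fermatA1
  exact lineRep_subst (fun x => x ^ 3) (fun x => 3 * x ^ 2) isSemialgebraicFunOn_pow_three
    (fun t _ => hasDerivWithinAt_pow_three _ t) injOn_pow_three image_pow_three
    (fun x hx => fermatA_pullback hx)

/-- **Move (`t = x³`): `F_B¹ ≡ ⅓ · β(⅔, 5/3)`.** -/
theorem fermatB1_sub_beta :
    of fermatB1 - of ((betaRep (2 / 3) (5 / 3) (by norm_num) (by norm_num)).constMul
      (((1:ℚ) / 3 : ℚ) : ℝ) (isAlgebraic_rat ℚ _)) ∈ relations := by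
  rw [betaRep_constMul_eq_lineRep]
  unfold fermatB1
  exact lineRep_subst (fun x => x ^ 3) (fun x => 3 * x ^ 2) isSemialgebraicFunOn_pow_three
    (fun t _ => hasDerivWithinAt_pow_three _ t) injOn_pow_three image_pow_three
    (fun x hx => fermatB_pullback hx)

/-- `β(⅓, 4/3) = ½ β(⅓,⅓)` (translation). -/
theorem betaQ_third_fourThirds :
    betaQ (1 / 3) (4 / 3) = (((1:ℚ) / 2 : ℚ) : K₀) • betaQ (1 / 3) (1 / 3) := by
  have h := betaQ_transl (a := 1 / 3) (b := 1 / 3) (by norm_num) (by norm_num)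
  rw [show ((1:ℚ) / 3 + 1 / 3 : ℚ) = 2 / 3 by norm_num,
    show ((1:ℚ) / 3 + 1 : ℚ) = 4 / 3 by norm_num] at h
  have h2 := congrArg (fun q : Q => (((3:ℚ) / 2 : ℚ) : K₀) • q) h
  simp only [smul_smul] at h2
  rw [show ((((3:ℚ) / 2 : ℚ) : K₀) * (((2:ℚ) / 3 : ℚ) : K₀)) = 1 by
      rw [← Rat.cast_mul]; norm_num, one_smul] at h2
  rw [h2, ← Rat.cast_mul]
  norm_num

/-- `β(⅔, 5/3) = ½ β(⅔,⅔)` (translation). -/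
theorem betaQ_twoThirds_fiveThirds :
    betaQ (2 / 3) (5 / 3) = (((1:ℚ) / 2 : ℚ) : K₀) • betaQ (2 / 3) (2 / 3) := by
  have h := betaQ_transl (a := 2 / 3) (b := 2 / 3) (by norm_num) (by norm_num)
  rw [show ((2:ℚ) / 3 + 2 / 3 : ℚ) = 4 / 3 by norm_num,
    show ((2:ℚ) / 3 + 1 : ℚ) = 5 / 3 by norm_num] at h
  have h2 := congrArg (fun q : Q => (((3:ℚ) / 4 : ℚ) : K₀) • q) h
  simp only [smul_smul] at h2
  rw [show ((((3:ℚ) / 4 : ℚ) : K₀) * (((4:ℚ) / 3 : ℚ) : K₀)) = 1 by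
      rw [← Rat.cast_mul]; norm_num, one_smul] at h2
  rw [h2, ← Rat.cast_mul]
  norm_num

/-- `[F_A¹] = (1/6) β(⅓,⅓)` in `Q`. -/
theorem mkQ_fermatA1 : mkQ (of fermatA1) = (((1:ℚ) / 6 : ℚ) : K₀) • betaQ (1 / 3) (1 / 3) := by
  have h : mkQ (of fermatA1) = (((1:ℚ) / 3 : ℚ) : K₀) • betaQ (1 / 3) (4 / 3) := by
    rw [betaQ_eq (by norm_num) (by norm_num), ← mkQ_constMul_ratCast, mkQ_eq_mkQ_iff]
    exact fermatA1_sub_beta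
  rw [h, betaQ_third_fourThirds, smul_smul, ← Rat.cast_mul]
  norm_num

/-- `[F_B¹] = (1/6) β(⅔,⅔)` in `Q`. -/
theorem mkQ_fermatB1 : mkQ (of fermatB1) = (((1:ℚ) / 6 : ℚ) : K₀) • betaQ (2 / 3) (2 / 3) := by
  have h : mkQ (of fermatB1) = (((1:ℚ) / 3 : ℚ) : K₀) • betaQ (2 / 3) (5 / 3) := by
    rw [betaQ_eq (by norm_num) (by norm_num), ← mkQ_constMul_ratCast, mkQ_eq_mkQ_iff]
    exact fermatB1_sub_beta
  rw [h, betaQ_twoThirds_fiveThirds, smul_smul, ← Rat.cast_mul]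
  norm_num

/-! ## The two rational planar regions -/

/-- The Fermat cubic quadrant `F_A = {0<x<1, 0≤y, x³+y³ ≤ 1}`. -/
def kzFermatA : Set (Fin 2 → ℝ) :=
  {z | (0 < z 0 ∧ z 0 < 1) ∧ 0 ≤ z 1 ∧ z 0 ^ 3 + z 1 ^ 3 ≤ 1}

/-- `F_B = {0<x<1, 0≤y, y³ ≤ x³(1-x³)²}`. -/
def kzFermatB : Set (Fin 2 → ℝ) :=
  {z | (0 < z 0 ∧ z 0 < 1) ∧ 0 ≤ z 1 ∧ z 1 ^ 3 ≤ z 0 ^ 3 * (1 - z 0 ^ 3) ^ 2}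

/-- Membership in `kzFermatA`, unfolded. -/
theorem mem_kzFermatA {z : Fin 2 → ℝ} :
    z ∈ kzFermatA ↔ (0 < z 0 ∧ z 0 < 1) ∧ 0 ≤ z 1 ∧ z 0 ^ 3 + z 1 ^ 3 ≤ 1 := Iff.rfl

/-- Membership in `kzFermatB`, unfolded. -/
theorem mem_kzFermatB {z : Fin 2 → ℝ} :
    z ∈ kzFermatB ↔ (0 < z 0 ∧ z 0 < 1) ∧ 0 ≤ z 1 ∧ z 1 ^ 3 ≤ z 0 ^ 3 * (1 - z 0 ^ 3) ^ 2 := .rfl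

/-- `kzFermatA` is `ℚ`-semialgebraic. -/
theorem isSemialgebraic_kzFermatA : IsSemialgebraic ℚ kzFermatA := by
  convert isSemialgebraic_subgraph (X 0 ^ 3 + X 1 ^ 3) 1 using 1
  ext z
  simp [kzFermatA]

/-- `kzFermatB` is `ℚ`-semialgebraic. -/
theorem isSemialgebraic_kzFermatB : IsSemialgebraic ℚ kzFermatB := by
  convert isSemialgebraic_subgraph (X 1 ^ 3) (X 0 ^ 3 * (1 - X 0 ^ 3) ^ 2) using 1
  ext z
  simp [kzFermatB]

/-- `kzFermatA` is the region under the graph of `fermatA`. -/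
theorem kzFermatA_eq : kzFermatA = {z | (0 < z 0 ∧ z 0 < 1) ∧ 0 ≤ z 1 ∧ z 1 ≤ fermatA (z 0)} := by
  ext z
  simp only [mem_kzFermatA, mem_setOf_eq]
  refine and_congr_right fun hx => and_congr_right fun hy => ?_
  have hw := one_sub_pow_three_pos hx
  rw [le_iff_pow_three_le hy (fermatA_nonneg hx), fermatA, rpow_third_pow_three hw.le]
  constructor <;> intro h <;> linarith

/-- `kzFermatB` is the region under the graph of `fermatB`. -/
theorem kzFermatB_eq : kzFermatB = {z | (0 < z 0 ∧ z 0 < 1) ∧ 0 ≤ z 1 ∧ z 1 ≤ fermatB (z 0)} := by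
  ext z
  simp only [mem_kzFermatB, mem_setOf_eq]
  refine and_congr_right fun hx => and_congr_right fun hy => ?_
  have hw := one_sub_pow_three_pos hx
  rw [le_iff_pow_three_le hy (fermatB_nonneg hx), fermatB, mul_pow, rpow_twoThirds_pow_three hw.le]

/-- `kzFermatA` lies in the unit square. -/
theorem kzFermatA_subset : kzFermatA ⊆ Icc 0 1 := subset_Icc_of_le_one fun z hz => by
  obtain ⟨hx, hy, h⟩ := hz
  refine ⟨hx, hy, ?_⟩
  have h3 : z 1 ^ 3 ≤ 1 := by nlinarith [pow_pos hx.1 3]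
  exact (pow_le_one_iff_of_nonneg hy three_ne_zero).mp h3

/-- `kzFermatB` lies in the unit square. -/
theorem kzFermatB_subset : kzFermatB ⊆ Icc 0 1 := subset_Icc_of_le_one fun z hz => by
  obtain ⟨hx, hy, h⟩ := hz
  refine ⟨hx, hy, ?_⟩
  have hx3 : z 0 ^ 3 ≤ 1 := (pow_three_lt_one hx).le
  have hw : (1 - z 0 ^ 3) ^ 2 ≤ 1 := by nlinarith [pow_pos hx.1 3]
  have h3 : z 1 ^ 3 ≤ 1 := h.trans (by nlinarith [pow_pos hx.1 3, sq_nonneg (1 - z 0 ^ 3)])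
  exact (pow_le_one_iff_of_nonneg hy three_ne_zero).mp h3

/-- **`F_A = [{0<x<1, 0≤y, x³+y³≤1}, 1]`**, with `ℚ`-rational data. -/
def fermatA2 : IntegralRep 2 :=
  ratRep kzFermatA (fun _ => 1) 1 1 isSemialgebraic_kzFermatA (fun _ _ => by simp)
    (fun _ _ => by simp) (integrableOn_one_of_subset_Icc kzFermatA_subset)

/-- **`F_B = [{0<x<1, 0≤y, y³≤x³(1-x³)²}, 1]`**, with `ℚ`-rational data. -/
def fermatB2 : IntegralRep 2 :=
  ratRep kzFermatB (fun _ => 1) 1 1 isSemialgebraic_kzFermatB (fun _ _ => by simp)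
    (fun _ _ => by simp) (integrableOn_one_of_subset_Icc kzFermatB_subset)

/-- `F_A` has KZ's literal rational shape. -/
theorem isRational_fermatA2 : fermatA2.IsRational := isRational_ratRep

/-- `F_B` has KZ's literal rational shape. -/
theorem isRational_fermatB2 : fermatB2.IsRational := isRational_ratRep

/-- **Move (Newton–Leibniz): `F_A ≡ F_A¹`.** -/
theorem fermatA2_sub_fermatA1 : of fermatA2 - of fermatA1 ∈ relations :=
  subgraph_sub_lineRep fermatA2 (fun _ hx => fermatA_nonneg hx) kzFermatA_eq rfl

/-- **Move (Newton–Leibniz): `F_B ≡ F_B¹`.** -/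
theorem fermatB2_sub_fermatB1 : of fermatB2 - of fermatB1 ∈ relations :=
  subgraph_sub_lineRep fermatB2 (fun _ hx => fermatB_nonneg hx) kzFermatB_eq rfl

/-- **`[F_A] = (1/6)•β(⅓,⅓)`** in `Q`: three moves (Newton–Leibniz, `t = x³`, translation). -/
theorem mkQ_fermatA2 : mkQ (of fermatA2) = (((1:ℚ) / 6 : ℚ) : K₀) • betaQ (1 / 3) (1 / 3) := by
  rw [← mkQ_fermatA1, mkQ_eq_mkQ_iff]
  exact fermatA2_sub_fermatA1

/-- **`[F_B] = (1/6)•β(⅔,⅔)`** in `Q`: three moves (Newton–Leibniz, `t = x³`, translation). -/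
theorem mkQ_fermatB2 : mkQ (of fermatB2) = (((1:ℚ) / 6 : ℚ) : K₀) • betaQ (2 / 3) (2 / 3) := by
  rw [← mkQ_fermatB1, mkQ_eq_mkQ_iff]
  exact fermatB2_sub_fermatB1

/-- The area of the Fermat cubic quadrant: `∫∫_{F_A} 1 = Γ(⅓)Γ(⅓)/(6Γ(⅔))`. -/
theorem fermatA2_value :
    fermatA2.value = Real.Gamma (1 / 3) * Real.Gamma (1 / 3) / (6 * Real.Gamma (2 / 3)) := by
  have h := congrArg evalQ mkQ_fermatA2
  rw [evalQ_mkQ, eval_of, evalQ_smul, evalQ_betaQ (by norm_num) (by norm_num),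
    coe_ratCast_K₀] at h
  rw [h]
  push_cast
  norm_num
  ring

/-- `∫∫_{F_B} 1 = Γ(⅔)Γ(⅔)/(6Γ(4/3))`. -/
theorem fermatB2_value :
    fermatB2.value = Real.Gamma (2 / 3) * Real.Gamma (2 / 3) / (6 * Real.Gamma (4 / 3)) := by
  have h := congrArg evalQ mkQ_fermatB2
  rw [evalQ_mkQ, eval_of, evalQ_smul, evalQ_betaQ (by norm_num) (by norm_num),
    coe_ratCast_K₀] at h
  rw [h]
  push_cast
  norm_num
  ring

end SoloBlind

end Summit.KontsevichZagierPeriods.KontsevichZagierPeriods.Theorems
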